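import Summits.ABC.ABC.Theorems.TwistAmplificationSharpModerateLawUnitPlaneDefs

/-!
# Crux `TwistAmplification.SharpModerateLaw` (stmt-ABC-1975), line `unit-plane-conic-two-torsion`:
stub `stub_fewDeepFlat`

The registered stub `stub_fewDeepFlat : FewDeepFlatLaw` (`FewDeepLaw → LawWithConeE FewDeepFlat 0`,
objects of `…SharpModerateLawUnitPlaneDefs.lean` / `…SharpModerateLawDefs.lean`): the companion line's
few-deep law (all scales `X, Y ≥ 1`) gives the cone law on the FLAT few-deep population.

Proof. For a datum `q = g·(u,v)` of the shell of a maximal form `F` with `m = |F(u,v)|` and flat part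
`m♭ = coprimePart (6·g·|Disc F|) m`:
* `m ≤ m_max(F, q, Y)` (from `|Disc F|·g⁶·m² ≤ Mplus F q < 2Y`, `primValue_le_mMax`);
* the floor `X^{−ε/4}·m_max ≤ m♭` then gives `m/m♭ ≤ X^{ε/4}`;
* `v(m) ∣ v(m♭) · (m/m♭)` prime by prime (`depthRad_dvd_depthRad_coprimePart_mul`), so the few-deep
  cap `g·rad|D|·v(m♭) ≤ X·Y^{−1/6}` on the flat part gives `g·rad|D|·v(m) ≤ X^{1+ε/4}·Y^{−1/6}`,
  i.e. the datum is few-deep at conductor budget `X' = X^{1+ε/4}` (`fewDeep_of_fewDeepFlat`);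
* hence `totalCount (FewDeepFlat ε) X Y ≤ totalCount FewDeep X' Y` (`totalCount_fewDeepFlat_le`),
  and `FewDeepLaw` at `ε' = ε/(2(1+ε/4))` bounds the right side by
  `C·X^{3ε/4}·Y^{ε'}·X·Y^{−1/6} ≤ C·(XY)^ε·X·Y^{−1/6}`.
-/

noncomputable section

-- the mandated summit namespace `Summit.ABC.ABC` (summit = problem) trips the duplicate-namespace linter
set_option linter.dupNamespace false

namespace Summit.ABC.ABC.Theorems.SharpModerateLaw.UnitPlane

open Literature.NumberTheory.CubicFields
open UniqueFactorizationMonoid (radical)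
open scoped BigOperators
open Finset
open FewDeepSlice

/-! ## 1. The coprime part through factorizations -/

/-- `coprimePart s n` is positive. -/
theorem coprimePart_pos (s n : ℕ) : 0 < coprimePart s n :=
  Finset.prod_pos fun _ hp => pow_pos (Nat.prime_of_mem_primeFactors (Finset.mem_filter.mp hp).1).pos _

/-- `v_p(coprimePart s n) = v_p(n)` for `p ∤ s` and `= 0` for `p ∣ s` (`n ≠ 0`, `p` prime). -/
theorem factorization_coprimePart {s n p : ℕ} (hn : n ≠ 0) (hp : p.Prime) :
    (coprimePart s n).factorization p = if p ∣ s then 0 else n.factorization p := by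
  classical
  unfold coprimePart
  rw [Nat.factorization_prod fun q hq =>
      pow_ne_zero _ (Nat.prime_of_mem_primeFactors (Finset.mem_filter.mp hq).1).ne_zero,
    Finset.sum_apply']
  have : ∀ q ∈ n.primeFactors.filter (fun q => ¬ q ∣ s),
      (q ^ n.factorization q).factorization p = if q = p then n.factorization q else 0 := by
    intro q hq
    rw [(Nat.prime_of_mem_primeFactors (Finset.mem_filter.mp hq).1).factorization_pow, Finsupp.single_apply]
  rw [Finset.sum_congr rfl this, Finset.sum_ite_eq']
  by_cases hps : p ∣ s
  · have hnot : p ∉ n.primeFactors.filter (fun q => ¬ q ∣ s) := fun h => (Finset.mem_filter.mp h).2 hps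
    rw [if_pos hps, if_neg hnot]
  · rw [if_neg hps]
    by_cases hpn : p ∈ n.primeFactors
    · rw [if_pos (Finset.mem_filter.mpr ⟨hpn, hps⟩)]
    · rw [if_neg (fun h => hpn (Finset.mem_filter.mp h).1),
        Nat.factorization_eq_zero_of_not_dvd (fun h => hpn (Nat.mem_primeFactors.mpr ⟨hp, h, hn⟩))]

/-- `coprimePart s n ∣ n`. -/
theorem coprimePart_dvd (s : ℕ) {n : ℕ} (hn : n ≠ 0) : coprimePart s n ∣ n := by
  rw [← Nat.factorization_le_iff_dvd (coprimePart_pos s n).ne' hn]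
  intro p
  by_cases hp : p.Prime
  · rw [factorization_coprimePart hn hp]
    split_ifs
    · exact Nat.zero_le _
    · exact le_rfl
  · simp [Nat.factorization_eq_zero_of_not_prime _ hp]

/-- **`v(n) ∣ v(n♭) · (n / n♭)`** for the coprime part `n♭ = coprimePart s n` of `n ≠ 0`: a prime `p` with
`p² ∣ n` has `p² ∣ n♭` if `p ∤ s` and `p ∣ n/n♭` if `p ∣ s`. -/
theorem depthRad_dvd_depthRad_coprimePart_mul {s n : ℕ} (hn : n ≠ 0) :
    depthRad n ∣ depthRad (coprimePart s n) * (n / coprimePart s n) := by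
  have hc0 : coprimePart s n ≠ 0 := (coprimePart_pos s n).ne'
  have hcd : coprimePart s n ∣ n := coprimePart_dvd s hn
  have hq0 : n / coprimePart s n ≠ 0 :=
    (Nat.div_pos (Nat.le_of_dvd (Nat.pos_of_ne_zero hn) hcd) (coprimePart_pos s n)).ne'
  rw [← Nat.factorization_le_iff_dvd (depthRad_pos n).ne' (mul_ne_zero (depthRad_pos _).ne' hq0),
    Nat.factorization_mul (depthRad_pos _).ne' hq0, Nat.factorization_div hcd]
  intro p
  simp only [Finsupp.add_apply, Finsupp.tsub_apply]
  by_cases hp : p.Prime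
  · rw [factorization_depthRad hn hp, factorization_depthRad hc0 hp]
    have h2n : p ^ 2 ∣ n ↔ 2 ≤ n.factorization p := hp.pow_dvd_iff_le_factorization hn
    have h2c : p ^ 2 ∣ coprimePart s n ↔ 2 ≤ (coprimePart s n).factorization p :=
      hp.pow_dvd_iff_le_factorization hc0
    rw [factorization_coprimePart hn hp] at h2c ⊢
    by_cases hps : p ∣ s
    · rw [if_pos hps] at h2c ⊢
      rw [Nat.sub_zero]
      by_cases h2 : p ^ 2 ∣ n
      · rw [if_pos h2]
        have := h2n.mp h2
        split_ifs <;> omega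
      · rw [if_neg h2]
        exact Nat.zero_le _
    · rw [if_neg hps] at h2c ⊢
      rw [Nat.sub_self, add_zero]
      by_cases h2 : p ^ 2 ∣ n
      · rw [if_pos h2, if_pos (h2c.mpr (h2n.mp h2))]
      · rw [if_neg h2]
        exact Nat.zero_le _
  · simp [Nat.factorization_eq_zero_of_not_prime _ hp]

/-! ## 2. One datum: flat few-deep at `X` is few-deep at `X^{1+ε/4}` -/

/-- **`m ≤ m_max`** on the shell: `|Disc F|·g⁶·m² ≤ Mplus F q < 2Y` gives `m ≤ (2Y/|Disc F|)^{1/2}/g³`. -/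
theorem primValue_le_mMax {F : BinaryCubic ℤ} (hD : F.disc ≠ 0) {q : ℤ × ℤ} (hF : F.eval q.1 q.2 ≠ 0)
    {Y : ℝ} (hY2 : (Mplus F q : ℝ) < 2 * Y) : (primValue F q : ℝ) ≤ mMax F q Y := by
  set g := Int.gcd q.1 q.2 with hg_def
  have hg0 : 0 < g := Int.gcd_pos_iff.mpr (by
    by_contra h; push Not at h; apply hF; rw [h.1, h.2]; simp [BinaryCubic.eval])
  set q₀ : ℤ × ℤ := (q.1 / (g : ℤ), q.2 / (g : ℤ)) with hq₀
  have e : ((g : ℤ) * q₀.1, (g : ℤ) * q₀.2) = q := by rw [hq₀]; exact smul_ediv_gcd q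
  have hM : Mplus F q = g ^ 6 * Mplus F q₀ := by rw [← mplus_smul, e]
  have hm : primValue F q = (F.eval q₀.1 q₀.2).natAbs := rfl
  have h1 : F.disc.natAbs * primValue F q ^ 2 ≤ Mplus F q₀ := by
    rw [hm, Mplus, ← Int.natAbs_pow, ← Int.natAbs_mul]
    exact le_max_left _ _
  have h2 : (F.disc.natAbs : ℝ) * (g : ℝ) ^ 6 * (primValue F q : ℝ) ^ 2 < 2 * Y := by
    have h3 : ((g ^ 6 * (F.disc.natAbs * primValue F q ^ 2) : ℕ) : ℝ) ≤ Mplus F q := by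
      rw [hM]; exact_mod_cast Nat.mul_le_mul_left _ h1
    push_cast at h3
    nlinarith
  have hDpos : (0 : ℝ) < F.disc.natAbs := by exact_mod_cast Int.natAbs_pos.mpr hD
  have hgpos : (0 : ℝ) < g := by exact_mod_cast hg0
  have h2Y : 0 ≤ 2 * Y := (Nat.cast_nonneg _).trans hY2.le
  unfold mMax
  rw [le_div_iff₀ (pow_pos hgpos 3), Real.le_sqrt (by positivity) (div_nonneg h2Y hDpos.le),
    le_div_iff₀ hDpos]
  nlinarith

/-- **One datum.** On the shell of a form with `Disc ≠ 0`, a flat few-deep datum at `(X, Y)` is in the shell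
and few-deep at `(X^{1+ε/4}, Y)` (`ε ≥ 0`, `X ≥ 1`). -/
theorem fewDeep_of_fewDeepFlat {F : BinaryCubic ℤ} (hD : F.disc ≠ 0) {ε X Y : ℝ} (hε : 0 ≤ ε)
    (hX : 1 ≤ X) {q : ℤ × ℤ} (hq : q ∈ ifShell F X Y) (hfl : FewDeepFlat ε X Y F q) :
    q ∈ ifShell F (X ^ (1 + ε / 4)) Y ∧ FewDeep (X ^ (1 + ε / 4)) Y F q := by
  obtain ⟨hF, hH, hG, hC, hY1, hY2, hN⟩ := hq
  obtain ⟨hcap, hfloor⟩ := hfl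
  have hX0 : 0 < X := by linarith
  have hY0 : 0 < Y := by
    have h2Y : (0 : ℝ) < 2 * Y := (Nat.cast_nonneg (Mplus F q)).trans_lt hY2
    linarith
  have hXe : 1 ≤ X ^ (ε / 4) := Real.one_le_rpow hX (by positivity)
  have hXa : X ^ (1 + ε / 4) = X * X ^ (ε / 4) := by rw [Real.rpow_add hX0, Real.rpow_one]
  have hXX : X ≤ X ^ (1 + ε / 4) := by rw [hXa]; exact le_mul_of_one_le_right hX0.le hXe
  refine ⟨⟨hF, hH, hG, hC, hY1, hY2, hN.trans hXX⟩, ?_⟩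
  -- the primitive value `m`, its flat part `c = m♭`, and `m / c ≤ X^{ε/4}`
  have hg0 : 0 < Int.gcd q.1 q.2 := Int.gcd_pos_iff.mpr (by
    by_contra h; push Not at h; apply hF; rw [h.1, h.2]; simp [BinaryCubic.eval])
  have hm0 : primValue F q ≠ 0 := by
    intro h0
    have e := smul_ediv_gcd q
    have h0' : F.eval (q.1 / (Int.gcd q.1 q.2 : ℤ)) (q.2 / (Int.gcd q.1 q.2 : ℤ)) = 0 :=
      Int.natAbs_eq_zero.mp h0
    apply hF
    rw [← e, eval_smul', h0', mul_zero]
  have hcd : mflat F q ∣ primValue F q := coprimePart_dvd _ hm0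
  have hc0 : 0 < mflat F q := coprimePart_pos _ _
  have hmle : (primValue F q : ℝ) ≤ mMax F q Y := primValue_le_mMax hD hF hY2
  have hfloor' : mMax F q Y ≤ X ^ (ε / 4) * (mflat F q : ℝ) := by
    rw [Real.rpow_neg hX0.le, inv_mul_le_iff₀ (Real.rpow_pos_of_pos hX0 _)] at hfloor
    exact hfloor
  have hquot : (((primValue F q / mflat F q : ℕ)) : ℝ) ≤ X ^ (ε / 4) := by
    rw [Nat.cast_div hcd (by exact_mod_cast hc0.ne'), div_le_iff₀ (by exact_mod_cast hc0)]
    exact hmle.trans hfloor'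
  have hle : ((depthRad (primValue F q) : ℕ) : ℝ) ≤
      ((depthRad (mflat F q) : ℕ) : ℝ) * ((primValue F q / mflat F q : ℕ) : ℝ) := by
    have hpos : 0 < depthRad (mflat F q) * (primValue F q / mflat F q) :=
      Nat.mul_pos (depthRad_pos _) (Nat.div_pos (Nat.le_of_dvd (Nat.pos_of_ne_zero hm0) hcd) hc0)
    exact_mod_cast Nat.le_of_dvd hpos (depthRad_dvd_depthRad_coprimePart_mul hm0)
  set A : ℝ := ((Int.gcd q.1 q.2 : ℕ) : ℝ) * ((radical F.disc.natAbs : ℕ) : ℝ) with hA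
  have hA0 : 0 ≤ A := by positivity
  show A * ((depthRad (primValue F q) : ℕ) : ℝ) ≤ X ^ (1 + ε / 4) * Y ^ (-(1 / 6 : ℝ))
  calc A * ((depthRad (primValue F q) : ℕ) : ℝ)
      ≤ A * (((depthRad (mflat F q) : ℕ) : ℝ) * ((primValue F q / mflat F q : ℕ) : ℝ)) :=
        mul_le_mul_of_nonneg_left hle hA0
    _ = A * ((depthRad (mflat F q) : ℕ) : ℝ) * ((primValue F q / mflat F q : ℕ) : ℝ) := by ring
    _ ≤ X * Y ^ (-(1 / 6 : ℝ)) * X ^ (ε / 4) := mul_le_mul hcap hquot (by positivity) (by positivity)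
    _ = X ^ (1 + ε / 4) * Y ^ (-(1 / 6 : ℝ)) := by rw [hXa]; ring

/-! ## 3. Counting: `totalCount (FewDeepFlat ε) X Y ≤ totalCount FewDeep X^{1+ε/4} Y` -/

/-- Per form: the flat few-deep shell count at `X` is at most the few-deep shell count at `X^{1+ε/4}`
(both vanish unless `F` is maximal; the larger set is finite by `finite_mplus_le`). -/
theorem shellCount_fewDeepFlat_le {ε X : ℝ} (hε : 0 ≤ ε) (hX : 1 ≤ X) (Y : ℝ) (F : BinaryCubic ℤ) :
    shellCount (FewDeepFlat ε) X Y F ≤ shellCount FewDeep (X ^ (1 + ε / 4)) Y F := by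
  unfold shellCount
  by_cases hM : RingOfForm.IsMaximal F
  · have hD : F.disc ≠ 0 := hM.disc_ne_zero
    refine Set.ncard_le_ncard (fun q hq => ⟨hq.1, fewDeep_of_fewDeepFlat hD hε hX hq.2.1 hq.2.2⟩) ?_
    exact (FewDeepSlice.finite_mplus_le hD ⌈2 * Y⌉₊).subset fun q hq => by
      have h : (Mplus F q : ℝ) < 2 * Y := hq.2.1.2.2.2.2.2.1
      exact_mod_cast (h.le.trans (Nat.le_ceil _) : (Mplus F q : ℝ) ≤ ⌈2 * Y⌉₊)
  · rw [Set.eq_empty_of_forall_notMem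
        (s := {q : ℤ × ℤ | RingOfForm.IsMaximal F ∧ q ∈ ifShell F X Y ∧ FewDeepFlat ε X Y F q})
        fun q hq => hM hq.1, Set.ncard_empty]
    exact Nat.zero_le _

/-- Orbit sums are monotone in the weight (finite sum for `D ≠ 0`). -/
theorem orbitTotal_mono {D : ℤ} (hD : D ≠ 0) {w₁ w₂ : BinaryCubic ℤ → ℕ}
    (h : ∀ F, w₁ F ≤ w₂ F) : orbitTotal D w₁ ≤ orbitTotal D w₂ := by
  haveI : Finite (orbitsOfDisc D) := finite_orbitsOfDisc hD
  haveI : Fintype (orbitsOfDisc D) := Fintype.ofFinite _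
  simp only [orbitTotal, finsum_eq_sum_of_fintype]
  exact Finset.sum_le_sum fun O _ => h _

/-- **The count comparison**: `totalCount (FewDeepFlat ε) X Y ≤ totalCount FewDeep X^{1+ε/4} Y`
(`ε ≥ 0`, `X ≥ 1`; same discriminant range, orbit by orbit). -/
theorem totalCount_fewDeepFlat_le {ε X : ℝ} (hε : 0 ≤ ε) (hX : 1 ≤ X) (Y : ℝ) :
    totalCount (FewDeepFlat ε) X Y ≤ totalCount FewDeep (X ^ (1 + ε / 4)) Y := by
  unfold totalCount
  exact Finset.sum_le_sum fun D hD =>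
    orbitTotal_mono (Finset.mem_erase.mp hD).1 fun F => shellCount_fewDeepFlat_le hε hX Y F

/-! ## 4. The stub -/

/-- **Flat few-deep law from the few-deep law**: `FewDeepLaw` at `ε' = ε/(2(1+ε/4))` and conductor budget
`X' = X^{1+ε/4}` gives `totalCount (FewDeepFlat ε) X Y ≤ max C 0 · (XY)^ε · X·Y^{−1/6}` for all `X, Y ≥ 1`
(the cone hypotheses are not used). -/
theorem lawWithConeE_fewDeepFlat (h : FewDeepLaw) : LawWithConeE FewDeepFlat 0 := by
  intro σ _ ε hε
  set a : ℝ := 1 + ε / 4 with ha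
  have ha0 : 0 < a := by positivity
  obtain ⟨C, hC⟩ := h (ε / (2 * a)) (by positivity)
  refine ⟨max C 0, fun X Y hX hY _ _ => ?_⟩
  have hX0 : 0 < X := by linarith
  have hY0 : 0 < Y := by linarith
  have hX'1 : 1 ≤ X ^ a := Real.one_le_rpow hX ha0.le
  have h1 := hC (X ^ a) Y hX'1 hY
  have hcount : (totalCount (FewDeepFlat ε) X Y : ℝ) ≤ (totalCount FewDeep (X ^ a) Y : ℝ) := by
    exact_mod_cast totalCount_fewDeepFlat_le hε.le hX Y
  have e1 : (X ^ a) ^ (ε / (2 * a)) = X ^ (ε / 2) := by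
    rw [← Real.rpow_mul hX0.le, show a * (ε / (2 * a)) = ε / 2 by field_simp]
  have e2 : X ^ a = X * X ^ (ε / 4) := by rw [ha, Real.rpow_add hX0, Real.rpow_one]
  have e3 : X ^ (ε / 2) * X ^ (ε / 4) = X ^ (3 * ε / 4) := by
    rw [← Real.rpow_add hX0]; ring_nf
  have hXe : X ^ (3 * ε / 4) ≤ X ^ ε := Real.rpow_le_rpow_of_exponent_le hX (by linarith)
  have hYe : Y ^ (ε / (2 * a)) ≤ Y ^ ε :=
    Real.rpow_le_rpow_of_exponent_le hY (by rw [div_le_iff₀ (by positivity), ha]; nlinarith)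
  set Q : ℝ := X * Y ^ (-(1 / 6 : ℝ)) with hQ
  have hQ0 : 0 ≤ Q := by positivity
  have hP : (X ^ a * Y) ^ (ε / (2 * a)) * (X ^ a * Y ^ (-(1 / 6 : ℝ)) + 0) =
      (X ^ (3 * ε / 4) * Y ^ (ε / (2 * a))) * Q := by
    rw [Real.mul_rpow (by positivity) hY0.le, e1, add_zero, e2, ← e3, hQ]; ring
  have hP' : (X ^ (3 * ε / 4) * Y ^ (ε / (2 * a))) * Q ≤ (X * Y) ^ ε * (Q + 0) := by
    rw [add_zero, Real.mul_rpow hX0.le hY0.le]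
    exact mul_le_mul_of_nonneg_right (mul_le_mul hXe hYe (by positivity) (by positivity)) hQ0
  have hPnn : 0 ≤ (X ^ (3 * ε / 4) * Y ^ (ε / (2 * a))) * Q := by positivity
  calc (totalCount (FewDeepFlat ε) X Y : ℝ) ≤ (totalCount FewDeep (X ^ a) Y : ℝ) := hcount
    _ ≤ C * (X ^ a * Y) ^ (ε / (2 * a)) * (X ^ a * Y ^ (-(1 / 6 : ℝ)) + 0) := h1
    _ = C * ((X ^ (3 * ε / 4) * Y ^ (ε / (2 * a))) * Q) := by rw [mul_assoc, hP]
    _ ≤ max C 0 * ((X ^ (3 * ε / 4) * Y ^ (ε / (2 * a))) * Q) :=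
        mul_le_mul_of_nonneg_right (le_max_left _ _) hPnn
    _ ≤ max C 0 * ((X * Y) ^ ε * (Q + 0)) := mul_le_mul_of_nonneg_left hP' (le_max_right _ _)
    _ = max C 0 * (X * Y) ^ ε * (X * Y ^ (-(1 / 6 : ℝ)) + 0) := by rw [hQ, mul_assoc]

/-- **Registered stub `stub_fewDeepFlat` of crux stmt-ABC-1975** (line `unit-plane-conic-two-torsion`): the
companion's few-deep law implies the cone law on the flat few-deep population. -/
theorem stub_fewDeepFlat : FewDeepFlatLaw := fun h => lawWithConeE_fewDeepFlat h

end Summit.ABC.ABC.Theorems.SharpModerateLaw.UnitPlane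

end
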